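/- Copyright: the b2b-balaban cell (near-miss cell 7), T⁴-continuum fan-out, NE7b crux team (2), leaf lineage
t4-ne7b-formalise-leaf-05 on the owner's INTERFACE REQUEST NE7b IR-41-7 (ii).  Released under the licence of the
surrounding project. -/
import Summits.QuantumFields.BalabanUV.T4Continuum.Support.HistoryGenealogyInstantiateM
import Summits.QuantumFields.BalabanUV.T4Continuum.Support.HistoryGenealogyInstantiateWF

/-!
# INSTANTIATION FROM THE LEVEL SETS, MEMORY-GENERIC PROCESS, part 2 (IR-41-7 (ii), brick 3b-M): `WF` of the
component bookkeeping extracted from the memory-generic process `RunInputM.StM` — the M-twin of row S15's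
`HistoryGenealogyInstantiateWF` (INTERFACE REQUEST NE7b IR-41-7 (ii) of the row-NE7b OWNER t4-ne7b-p1 gen 41; filed by
leaf lineage t4-ne7b-formalise-leaf-05 — PRE-POSITIONING ONLY)

Summits-side support leaf of the T⁴-continuum cell (rung (B)+1 on a FINITE torus only; NOT infinite volume, NOT the
mass gap, NOT the Clay statement; NOT a proof of the spine estimate NE7b, which is the cell's OWN estimate, NOT PRINTED
and NOT PROVED).  [folklore] finite combinatorics over part 1-M (`RunInputM.histM`, `StM_nonempty_disjoint`,
`constit_lab_newLineM`, `enumBM_spec`, `mem_compM_iff`), row S15 brick 3b's generic list lemmas (`RunInput.lefts_map_sumMap`,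
`rights_map_sumMap`, `nodup_lefts`, `nodup_rights` — REUSED), brick 2 (`disjoint_of_ne`, `subset_of_mem_tcomps`,
`nonempty_of_mem_tcomps`) and row S13 (`WF`, `lefts`, `rights`); nothing printed is asserted, zero `sorry`.

WHAT IS PROVED.  `mem_partsM_iff`, `mem_newsM_iff`, `not_inl_mem_vertM_zero`; **`wf_histM : (I.histM).WF`** — row S13's
printed side conditions HOLD for the bookkeeping extracted from the memory-generic construction (row S15's proof with
`Rdy ↦ RdyM`, nothing else changed).

HONEST.  Proves nothing of Bałaban's; NE7b NOT proved; spine 0∕9.  HONEST DEPENDENCY (cell): continuum YM on T⁴ ⇐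
BetaPertH ∧ nine spine estimates (0/9 proved); BetaPertH ⇐ (D1) ∧ (D4) ∧ CAP+tail; G-an2-4 gates asym, D1 and NE2/3/4.
This file changes none of it. -/

open Finset
open Literature.MathematicalPhysics.QuantumFieldTheory.Balaban1983to89
open Literature.MathematicalPhysics.QuantumFieldTheory.Balaban1983to89.B13ScaleTransfer
open Literature.MathematicalPhysics.QuantumFieldTheory.Balaban1983to89.B16MergeGeometry
open Summit.QuantumFields.BalabanUV.T4Continuum.HistoryGenealogyExtraction
open Summit.QuantumFields.BalabanUV.T4Continuum.HistoryGenealogyRealise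
open Summit.QuantumFields.BalabanUV.T4Continuum.HistoryTouchComponents

namespace Summit.QuantumFields.BalabanUV.T4Continuum.HistoryGenealogyInstantiate

noncomputable section

open Classical

variable {d : ℕ}

namespace RunInputM

variable (I : RunInputM d)

/-! ## §1 Parts and news of a component of the memory-generic process -/

/-- the old parts of the component of a block: the labels of the old vertices of the block [folklore] -/
theorem mem_partsM_iff (hN : I.NewOK) {ℓ : ℕ} {T : Finset (Line d ⊕ Lab d)} (hT : T ∈ I.blocksM ℓ (I.PrevM ℓ)) {p : Lab d} :
    p ∈ I.histM.parts ℓ (lab (I.newLineM ℓ T)) ↔ ∃ τ, Sum.inl τ ∈ T ∧ lab τ = p := by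
  rw [ComponentHistory.parts, I.constit_lab_newLineM hN hT, toLab, RunInput.lefts_map_sumMap, List.mem_map]
  simp only [mem_lefts_iff, (I.enumBM_spec hT).2.1]

/-- the new regions of the component of a block: the new vertices of the block [folklore] -/
theorem mem_newsM_iff (hN : I.NewOK) {ℓ : ℕ} {T : Finset (Line d ⊕ Lab d)} (hT : T ∈ I.blocksM ℓ (I.PrevM ℓ)) {n : Lab d} :
    n ∈ I.histM.news ℓ (lab (I.newLineM ℓ T)) ↔ Sum.inr n ∈ T := by
  rw [ComponentHistory.news, I.constit_lab_newLineM hN hT, toLab, RunInput.rights_map_sumMap, List.map_id, mem_rights_iff]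
  exact (I.enumBM_spec hT).2.1 _

/-! ## §2 Well-formedness of the extracted bookkeeping -/

/-- at level `0` there are no old vertices [folklore] -/
theorem not_inl_mem_vertM_zero (τ : Line d) : Sum.inl τ ∉ I.vertM 0 (I.PrevM 0) := by
  simp [vertM, PrevM]

/-- **`WF` OF THE EXTRACTED BOOKKEEPING** (under `NewOK`). [folklore] -/
theorem wf_histM (hN : I.NewOK) : I.histM.WF where
  parts_zero c := by
    by_cases h : ∃ T ∈ I.blocksM 0 (I.PrevM 0), lab (I.newLineM 0 T) = c
    · obtain ⟨T, hT, rfl⟩ := h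
      rw [List.eq_nil_iff_forall_not_mem]
      intro p hp
      obtain ⟨τ, hτT, -⟩ := (I.mem_partsM_iff hN hT).1 hp
      exact I.not_inl_mem_vertM_zero τ (subset_of_mem_tcomps hT hτT)
    · simp [ComponentHistory.parts, I.constitM_eq_nil h]
  parts_nodup ℓ c := by
    by_cases h : ∃ T ∈ I.blocksM ℓ (I.PrevM ℓ), lab (I.newLineM ℓ T) = c
    · obtain ⟨T, hT, rfl⟩ := h
      rw [ComponentHistory.parts, I.constit_lab_newLineM hN hT, toLab, RunInput.lefts_map_sumMap]
      refine (RunInput.nodup_lefts (I.enumBM_spec hT).1).map_on fun τ hτ τ' hτ' hl => ?_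
      have hτv := subset_of_mem_tcomps hT (((I.enumBM_spec hT).2.1 _).1 ((mem_lefts_iff τ _).1 hτ))
      have hτv' := subset_of_mem_tcomps hT (((I.enumBM_spec hT).2.1 _).1 ((mem_lefts_iff τ' _).1 hτ'))
      cases ℓ with
      | zero => exact absurd hτv (I.not_inl_mem_vertM_zero τ)
      | succ ℓ => exact I.lab_injOn_StM hN ℓ ((I.inl_mem_vertM).1 hτv).1 ((I.inl_mem_vertM).1 hτv').1 hl
    · simp [ComponentHistory.parts, I.constitM_eq_nil h]
  news_nodup ℓ c := by
    by_cases h : ∃ T ∈ I.blocksM ℓ (I.PrevM ℓ), lab (I.newLineM ℓ T) = c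
    · obtain ⟨T, hT, rfl⟩ := h
      rw [ComponentHistory.news, I.constit_lab_newLineM hN hT, toLab, RunInput.rights_map_sumMap, List.map_id]
      exact RunInput.nodup_rights (I.enumBM_spec hT).1
    · simp [ComponentHistory.news, I.constitM_eq_nil h]
  parts_sub ℓ c hc p hp := by
    obtain ⟨T, hT, rfl⟩ := I.mem_compM_iff.1 hc
    obtain ⟨τ, hτT, rfl⟩ := (I.mem_partsM_iff hN hT).1 hp
    have hτ := ((I.inl_mem_vertM).1 (subset_of_mem_tcomps hT hτT)).1
    exact Finset.mem_image.2 ⟨τ, hτ, rfl⟩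
  news_sub ℓ c hc n hn := by
    obtain ⟨T, hT, rfl⟩ := I.mem_compM_iff.1 hc
    exact (I.inr_mem_vertM).1 (subset_of_mem_tcomps hT ((I.mem_newsM_iff hN hT).1 hn))
  nonempty ℓ c hc := by
    obtain ⟨T, hT, rfl⟩ := I.mem_compM_iff.1 hc
    rw [I.constit_lab_newLineM hN hT]
    obtain ⟨v, hv⟩ := nonempty_of_mem_tcomps hT
    have hv' := ((I.enumBM_spec hT).2.1 v).2 hv
    intro h
    rw [List.map_eq_nil_iff] at h
    rw [h] at hv'
    simp at hv'
  parts_disj ℓ c c' hc hc' hne := by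
    obtain ⟨T, hT, rfl⟩ := I.mem_compM_iff.1 hc
    obtain ⟨T', hT', rfl⟩ := I.mem_compM_iff.1 hc'
    have hTT : T ≠ T' := fun h => hne (by rw [h])
    rw [Finset.disjoint_left]
    intro p hp hp'
    rw [List.mem_toFinset] at hp hp'
    obtain ⟨τ, hτT, rfl⟩ := (I.mem_partsM_iff hN hT).1 hp
    obtain ⟨τ', hτ'T, hl⟩ := (I.mem_partsM_iff hN hT').1 hp'
    have hτv := (I.inl_mem_vertM).1 (subset_of_mem_tcomps hT hτT)
    have hτv' := (I.inl_mem_vertM).1 (subset_of_mem_tcomps hT' hτ'T)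
    have heq : τ' = τ := I.lab_injOn_StM hN ℓ hτv'.1 hτv.1 hl
    subst heq
    exact Finset.disjoint_left.1 (disjoint_of_ne hT hT' hTT) hτT hτ'T
  news_disj ℓ c c' hc hc' hne := by
    obtain ⟨T, hT, rfl⟩ := I.mem_compM_iff.1 hc
    obtain ⟨T', hT', rfl⟩ := I.mem_compM_iff.1 hc'
    have hTT : T ≠ T' := fun h => hne (by rw [h])
    rw [Finset.disjoint_left]
    intro n hn hn'
    rw [List.mem_toFinset] at hn hn'
    exact Finset.disjoint_left.1 (disjoint_of_ne hT hT' hTT) ((I.mem_newsM_iff hN hT).1 hn) ((I.mem_newsM_iff hN hT').1 hn')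


end RunInputM

end

end Summit.QuantumFields.BalabanUV.T4Continuum.HistoryGenealogyInstantiate
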